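import Summits.KontsevichZagierPeriods.KontsevichZagierPeriods.Theorems.MultiplicationThree.Negative.Pinned
import Literature.NumberTheory.Transcendental.SemialgebraicLineDeriv
import Literature.NumberTheory.Transcendental.KZSemialgebraicComplex

/-!
# `NegativeBranchToMaxCell` (stmt-KontsevichZagierPeriods-14675, route TerasomaMultiplication) — part 1: cells, the level chart

Support item of crux 2 (`MultiplicationThree`): for every rational `s > 0`,
`[Σ_neg = {0<u<1, a<0}, u^(s−1)/√Q(a,u)] ~ [M₃ = {σ ∈ Δ : σ₃ > σ₁, σ₃ > σ₂}, (σ₁σ₂σ₃)^(s−1)]`,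
`Q(a,u) = a²(3−a)² − 4ua`, `σ₃ = 3 − σ₁ − σ₂`.

The proof (`TerasomaMultiplicationNegativeBranchToMaxCell.lean`) is a chain of THREE instances of
Kontsevich–Zagier's rule (2) (change of variables), written in the base coordinate `t = a₁(u)`, the
root in `(0,1)` of `t(3−t)² = 4u` (the abscissa of the real 2-torsion point of the level cubic
`E_u : w² = Q(a,u)`): with `u = lev t := t(3−t)²/4` EVERY map of the chain is rational or a square
root, so all side conditions of the tree's `KZ.changeOfVariablesRel` (ℚ-semialgebraic graph,
derivative, injectivity, image, Jacobian identity) are elementary.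

This file: the cells `negCell = Σ_neg` (literally the route's domain clause), `midCell =
{0<t<1, t<a, 2a<3−t}`; the level polynomial `lev`, its derivative `levD`, injectivity and
surjectivity of `lev : (0,1) → (0,1)`; `Q`; the literal route integrand `negFun` and the common
intermediate integrand `tFun s (t,a) = levD t · (lev t)^(s−1)/√Q(a, lev t)` (ℚ-semialgebraic via
`KZ.isSemialgebraicFunOn_mellinIntegrand` and the tree's `fun_sqrt`/`div`); and MOVE 1, the level
chart `rootChart (t,a) = (lev t, a)` of `Σ_neg` by itself:
`[Σ_neg, tFun s] − [Σ_neg, negFun s] ∈ KZ.changeOfVariablesRel` (`rootChart_move`).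
Parts 2–3 (`…Mobius.lean`, `…Unshear.lean`) are the other two moves. No integrability estimate is
made anywhere: the intermediate representations inherit absolute convergence from the given `r`
through Mathlib's Jacobian criterion. Sources: Kontsevich–Zagier 2001 §1.2 (rules); Cassels 1991
(quartic models of curves of genus one: translation by a 2-torsion point of `w² = ∏(a − eᵢ)` acts on
the `a`-line by a Möbius involution preserving the root set).
-/

noncomputable section

open MeasureTheory Set Real
open scoped BigOperators

namespace Summit.KontsevichZagierPeriods.TerasomaMultiplication.NegativeBranchToMaxCell

open Literature.NumberTheory.Transcendental
open Literature.NumberTheory.Transcendental.KZ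
open Literature.ModelTheory.ExponentialFields (IsSemialgebraic)
open MvPolynomial (aeval X C)

/-! ### The cells -/

/-- `Σ_neg = {0 < u < 1, a < 0}` (coordinates `x 0 = u` or `t`, `x 1 = a`), literally the route's
domain clause; it is also the domain of the `t`-chart, `lev` mapping `(0,1)` onto itself. [folklore] -/
def negCell : Set (Fin 2 → ℝ) := {x | 0 < x 0 ∧ x 0 < 1 ∧ x 1 < 0}

/-- The middle cell `{0 < t < 1, t < a, 2a < 3 − t}`: over `t`, the arc of the `a`-line between the
2-torsion abscissa `a₁ = t` and the mirror abscissa `b₁ = (3 − t)/2`. [folklore] -/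
def midCell : Set (Fin 2 → ℝ) := {x | 0 < x 0 ∧ x 0 < 1 ∧ x 0 < x 1 ∧ 2 * x 1 < 3 - x 0}

/-- Defining polynomials of `Σ_neg`. [folklore] -/
def negCellPolys : Fin 3 → MvPolynomial (Fin 2) ℚ := ![X 0, 1 - X 0, -X 1]

/-- Defining polynomials of the middle cell. [folklore] -/
def midCellPolys : Fin 4 → MvPolynomial (Fin 2) ℚ := ![X 0, 1 - X 0, X 1 - X 0, 3 - X 0 - 2 * X 1]

/-- `Σ_neg` as a positivity set. [folklore] -/
theorem negCell_eq : negCell = {x | ∀ l, 0 < aeval x (negCellPolys l)} := by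
  ext x
  simp only [negCell, mem_setOf_eq, Fin.forall_fin_succ, negCellPolys, Matrix.cons_val_zero,
    Matrix.cons_val_succ, map_sub, map_one, map_neg, MvPolynomial.aeval_X]
  constructor
  · rintro ⟨h0, h1, h2⟩; exact ⟨h0, by linarith, by linarith, fun i => Fin.elim0 i⟩
  · rintro ⟨h0, h1, h2, -⟩; exact ⟨h0, by linarith, by linarith⟩

/-- The middle cell as a positivity set. [folklore] -/
theorem midCell_eq : midCell = {x | ∀ l, 0 < aeval x (midCellPolys l)} := by
  ext x
  simp only [midCell, mem_setOf_eq, Fin.forall_fin_succ, midCellPolys, Matrix.cons_val_zero,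
    Matrix.cons_val_succ, map_sub, map_mul, MvPolynomial.aeval_X, map_one, map_ofNat]
  constructor
  · rintro ⟨h0, h1, h2, h3⟩; exact ⟨h0, by linarith, by linarith, by linarith, fun i => Fin.elim0 i⟩
  · rintro ⟨h0, h1, h2, h3, -⟩; exact ⟨h0, by linarith, by linarith, by linarith⟩

/-- `Σ_neg` is `ℚ`-semialgebraic. [folklore] -/
theorem isSemialgebraic_negCell : IsSemialgebraic ℚ negCell := by
  rw [negCell_eq]; exact isSemialgebraic_setOf_forall_aeval_pos _

/-- The middle cell is `ℚ`-semialgebraic. [folklore] -/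
theorem isSemialgebraic_midCell : IsSemialgebraic ℚ midCell := by
  rw [midCell_eq]; exact isSemialgebraic_setOf_forall_aeval_pos _

/-- `Σ_neg` is measurable. [folklore] -/
theorem measurableSet_negCell : MeasurableSet negCell :=
  IsSemialgebraic.measurableSet_holds isSemialgebraic_negCell

/-! ### The level polynomial `lev t = t(3−t)²/4` -/

/-- The level `u = lev t = t(3 − t)²/4` as a function of the 2-torsion abscissa `t`
(`t(3 − t)² = 4u`). [folklore] -/
def lev (t : ℝ) : ℝ := t * (3 - t) ^ 2 / 4

/-- `lev' t = (3/4)(1 − t)(3 − t)`. [folklore] -/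
def levD (t : ℝ) : ℝ := 3 / 4 * (1 - t) * (3 - t)

/-- `lev` has derivative `levD`. [folklore] -/
theorem hasDerivAt_lev (t : ℝ) : HasDerivAt lev (levD t) t := by
  have h1 : HasDerivAt (fun y : ℝ => 3 - y) (-1) t := by
    simpa using (hasDerivAt_id t).const_sub 3
  have hfun : lev = fun y : ℝ => y * (3 - y) * (3 - y) / 4 := by
    funext y; simp only [lev]; ring
  rw [hfun]
  refine ((((hasDerivAt_id' t).mul h1).mul h1).div_const 4).congr_deriv ?_
  simp only [levD, Pi.mul_apply]; ring

/-- `lev` is continuous. [folklore] -/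
theorem continuous_lev : Continuous lev := by
  unfold lev; fun_prop

/-- `levD > 0` on `t < 1`. [folklore] -/
theorem levD_pos {t : ℝ} (ht : t < 1) : 0 < levD t := by
  unfold levD
  have h1 : 0 < 1 - t := by linarith
  have h3 : 0 < 3 - t := by linarith
  positivity

/-- The difference quotient of `lev`. [folklore] -/
theorem lev_sub_lev (a t : ℝ) : lev a - lev t = (a - t) * ((3 - a - t) ^ 2 - a * t) / 4 := by
  unfold lev; ring

/-- `1 − lev a = (1 − a)²(4 − a)/4`. [folklore] -/
theorem one_sub_lev (a : ℝ) : 1 - lev a = (1 - a) ^ 2 * (4 - a) / 4 := by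
  unfold lev; ring

/-- `lev` is strictly increasing on `(0, 1]`. [folklore] -/
theorem lev_lt_lev {t a : ℝ} (ht0 : 0 < t) (hta : t < a) (ha1 : a ≤ 1) : lev t < lev a := by
  have h1 : 1 < 3 - a - t := by linarith
  have h2 : a * t < 1 := by nlinarith
  have h3 : 1 < (3 - a - t) ^ 2 := by nlinarith
  have key := lev_sub_lev a t
  nlinarith

/-- `lev` is injective on `(0,1)`. [folklore] -/
theorem lev_injOn : InjOn lev (Ioo (0:ℝ) 1) := by
  intro a ha b hb h
  rcases lt_trichotomy a b with hab | hab | hab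
  · exact absurd h (lev_lt_lev ha.1 hab hb.2.le).ne
  · exact hab
  · exact absurd h (lev_lt_lev hb.1 hab ha.2.le).ne'

/-- `lev 0 = 0`. [folklore] -/
@[simp] theorem lev_zero : lev 0 = 0 := by simp [lev]

/-- `lev 1 = 1`. [folklore] -/
@[simp] theorem lev_one : lev 1 = 1 := by norm_num [lev]

/-- `lev` maps `(0,1)` into `(0,1)`. [folklore] -/
theorem lev_mem_Ioo {t : ℝ} (ht : t ∈ Ioo (0:ℝ) 1) : lev t ∈ Ioo (0:ℝ) 1 := by
  refine ⟨?_, ?_⟩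
  · unfold lev
    have : 0 < 3 - t := by linarith [ht.2]
    have := ht.1
    positivity
  · simpa using lev_lt_lev ht.1 ht.2 le_rfl

/-- `lev` maps `(0,1)` ONTO `(0,1)` (intermediate value theorem): the 2-torsion abscissa
`a₁(u) ∈ (0,1)` exists for every level `u ∈ (0,1)`. [folklore] -/
theorem exists_lev_eq {u : ℝ} (hu0 : 0 < u) (hu1 : u < 1) : ∃ t ∈ Ioo (0:ℝ) 1, lev t = u := by
  have h := intermediate_value_Ioo (zero_le_one' ℝ) continuous_lev.continuousOn
  rw [lev_zero, lev_one] at h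
  obtain ⟨t, ht, rfl⟩ := h ⟨hu0, hu1⟩
  exact ⟨t, ht, rfl⟩

/-! ### The quartic `Q(a,u) = a²(3−a)² − 4ua` -/

/-- `Q(a,u) = a²(3 − a)² − 4ua`: the level cubic `σ₁σ₂σ₃ = u`, `Σσ = 3` in the coordinates
`a = σ₁`, `w = σ₁(σ₃ − σ₂)` is `w² = Q(a,u)`. [folklore] -/
def Qf (a u : ℝ) : ℝ := a ^ 2 * (3 - a) ^ 2 - 4 * u * a

/-- `Q > 0` on the negative branch. [folklore] -/
theorem Qf_pos_of_neg {a u : ℝ} (ha : a < 0) (hu : 0 < u) : 0 < Qf a u := by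
  unfold Qf
  nlinarith [sq_nonneg (a * (3 - a)), mul_pos hu (neg_pos.2 ha)]

/-- `Q(a, lev t) = 4a(lev a − lev t)`. [folklore] -/
theorem Qf_lev_eq (a t : ℝ) : Qf a (lev t) = a * (4 * (lev a - lev t)) := by
  unfold Qf lev; ring

/-- On the middle cell the level increases from `t` to `a`: `lev t < lev a`. [folklore] -/
theorem lev_lt_lev_of_mem_midCell {x : Fin 2 → ℝ} (hx : x ∈ midCell) : lev (x 0) < lev (x 1) := by
  obtain ⟨h0, h1, h2, h3⟩ := hx
  have key := lev_sub_lev (x 1) (x 0)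
  have hq : (3 - x 1 - x 0) ^ 2 - x 1 * x 0 =
      3 * (3 - x 0) * (1 - x 0) / 4 + ((3 - x 0) / 2 - x 1) * (9 / 2 - x 0 / 2 - x 1) := by ring
  have hpos : 0 < (3 - x 1 - x 0) ^ 2 - x 1 * x 0 := by
    rw [hq]
    have ha : 0 < (3 - x 0) / 2 - x 1 := by linarith
    have hb : 0 < 9 / 2 - x 0 / 2 - x 1 := by linarith
    have hc : 0 < 3 * (3 - x 0) * (1 - x 0) / 4 := by
      have : 0 < 3 - x 0 := by linarith
      have : 0 < 1 - x 0 := by linarith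
      positivity
    positivity
  nlinarith

/-- `Q(a, lev t) > 0` on the middle cell. [folklore] -/
theorem Qf_pos_of_mem_midCell {x : Fin 2 → ℝ} (hx : x ∈ midCell) : 0 < Qf (x 1) (lev (x 0)) := by
  rw [Qf_lev_eq]
  have ha : 0 < x 1 := by obtain ⟨h0, -, h2, -⟩ := hx; linarith
  exact mul_pos ha (by linarith [lev_lt_lev_of_mem_midCell hx])

/-- `Q(a, lev t) > 0` on `Σ_neg`. [folklore] -/
theorem Qf_pos_of_mem_negCell {x : Fin 2 → ℝ} (hx : x ∈ negCell) : 0 < Qf (x 1) (lev (x 0)) :=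
  Qf_pos_of_neg hx.2.2 (lev_mem_Ioo ⟨hx.1, hx.2.1⟩).1

/-! ### The integrands -/

/-- The route's integrand on `Σ_neg`, literally: `u^(s−1)/√(a²(3−a)² − 4ua)`. [folklore] -/
def negFun (s : ℚ) (x : Fin 2 → ℝ) : ℝ :=
  (x 0) ^ ((s:ℝ) - 1) / Real.sqrt ((x 1) ^ 2 * (3 - x 1) ^ 2 - 4 * x 0 * x 1)

/-- The common intermediate integrand in `t`-coordinates:
`tFun s (t,a) = lev'(t) · (lev t)^(s−1) / √Q(a, lev t)`. [folklore] -/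
def tFun (s : ℚ) (x : Fin 2 → ℝ) : ℝ :=
  levD (x 0) * lev (x 0) ^ ((s:ℝ) - 1) / Real.sqrt (Qf (x 1) (lev (x 0)))

/-- The level polynomial as an `MvPolynomial` in `x 0`. [folklore] -/
def levPoly : MvPolynomial (Fin 2) ℚ := C (1/4 : ℚ) * X 0 * (3 - X 0) ^ 2

/-- Evaluating `levPoly`. [folklore] -/
theorem aeval_levPoly (x : Fin 2 → ℝ) : aeval x levPoly = lev (x 0) := by
  simp [levPoly, lev]
  ring

/-- `Q(a, lev t)` as an `MvPolynomial`. [folklore] -/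
def QlevPoly : MvPolynomial (Fin 2) ℚ := X 1 ^ 2 * (3 - X 1) ^ 2 - 4 * levPoly * X 1

/-- Evaluating `QlevPoly`. [folklore] -/
theorem aeval_QlevPoly (x : Fin 2 → ℝ) : aeval x QlevPoly = Qf (x 1) (lev (x 0)) := by
  simp [QlevPoly, aeval_levPoly, Qf]

/-- `lev'` as an `MvPolynomial`. [folklore] -/
def levDPoly : MvPolynomial (Fin 2) ℚ := C (3/4 : ℚ) * (1 - X 0) * (3 - X 0)

/-- Evaluating `levDPoly`. [folklore] -/
theorem aeval_levDPoly (x : Fin 2 → ℝ) : aeval x levDPoly = levD (x 0) := by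
  simp [levDPoly, levD]

/-- The common integrand is `ℚ`-semialgebraic on every `ℚ`-semialgebraic set on which `lev t > 0`
and `Q(a, lev t) > 0` (rational power via `KZ.isSemialgebraicFunOn_mellinIntegrand`, square root via
the tree's `fun_sqrt`). [folklore] -/
theorem isSemialgebraicFunOn_tFun (s : ℚ) {S : Set (Fin 2 → ℝ)} (hS : IsSemialgebraic ℚ S)
    (hlev : ∀ x ∈ S, 0 < lev (x 0)) (hQ : ∀ x ∈ S, 0 < Qf (x 1) (lev (x 0))) :
    IsSemialgebraicFunOn ℚ S (tFun s) := by
  have h1 : IsSemialgebraicFunOn ℚ S (fun x => levD (x 0)) :=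
    (isSemialgebraicFunOn_aeval hS levDPoly).congr fun x _ => aeval_levDPoly x
  have h2 : IsSemialgebraicFunOn ℚ S (fun x => lev (x 0) ^ ((s:ℝ) - 1)) := by
    refine (isSemialgebraicFunOn_mellinIntegrand hS ![levPoly] ![s - 1] 1 ?_).congr fun x _ => ?_
    · intro x hx k
      fin_cases k
      simpa [aeval_levPoly] using hlev x hx
    · simp [mellinIntegrand, aeval_levPoly]
  have h3 : IsSemialgebraicFunOn ℚ S (fun x => Real.sqrt (Qf (x 1) (lev (x 0)))) :=
    ((isSemialgebraicFunOn_aeval hS QlevPoly).congr fun x _ => aeval_QlevPoly x).fun_sqrt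
  exact ((h1.fun_mul h2).div h3 fun x hx => (Real.sqrt_pos.2 (hQ x hx)).ne').congr fun x _ => rfl

/-- The common integrand is `ℚ`-semialgebraic on `Σ_neg`. [folklore] -/
theorem isSemialgebraicFunOn_tFun_negCell (s : ℚ) : IsSemialgebraicFunOn ℚ negCell (tFun s) :=
  isSemialgebraicFunOn_tFun s isSemialgebraic_negCell (fun _ hx => (lev_mem_Ioo ⟨hx.1, hx.2.1⟩).1)
    fun _ hx => Qf_pos_of_mem_negCell hx

/-- The common integrand is `ℚ`-semialgebraic on the middle cell. [folklore] -/
theorem isSemialgebraicFunOn_tFun_midCell (s : ℚ) : IsSemialgebraicFunOn ℚ midCell (tFun s) :=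
  isSemialgebraicFunOn_tFun s isSemialgebraic_midCell (fun _ hx => (lev_mem_Ioo ⟨hx.1, hx.2.1⟩).1)
    fun _ hx => Qf_pos_of_mem_midCell hx

/-! ### Move 1: the level chart `rootChart (t, a) = (lev t, a)` of `Σ_neg` by itself -/

/-- The level chart `(t, a) ↦ (lev t, a)`. [folklore] -/
def rootChart (x : Fin 2 → ℝ) : Fin 2 → ℝ := ![lev (x 0), x 1]

/-- First component. [folklore] -/
@[simp] theorem rootChart_apply_zero (x : Fin 2 → ℝ) : rootChart x 0 = lev (x 0) := rfl

/-- Second component. [folklore] -/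
@[simp] theorem rootChart_apply_one (x : Fin 2 → ℝ) : rootChart x 1 = x 1 := rfl

/-- Jacobian matrix of the level chart. [folklore] -/
def rootJac (x : Fin 2 → ℝ) : Matrix (Fin 2) (Fin 2) ℝ := !![levD (x 0), 0; 0, 1]

/-- Derivative of the level chart. [folklore] -/
def rootChart' (x : Fin 2 → ℝ) : (Fin 2 → ℝ) →L[ℝ] (Fin 2 → ℝ) :=
  LinearMap.toContinuousLinearMap (Matrix.toLin' (rootJac x))

/-- Derivative applied to a vector, first component. [folklore] -/
@[simp] theorem rootChart'_apply_zero (x v : Fin 2 → ℝ) : rootChart' x v 0 = levD (x 0) * v 0 := by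
  change Matrix.toLin' (rootJac x) v 0 = _
  rw [Matrix.toLin'_apply]
  simp [rootJac, Matrix.mulVec, dotProduct, Fin.sum_univ_two]

/-- Derivative applied to a vector, second component. [folklore] -/
@[simp] theorem rootChart'_apply_one (x v : Fin 2 → ℝ) : rootChart' x v 1 = v 1 := by
  change Matrix.toLin' (rootJac x) v 1 = _
  rw [Matrix.toLin'_apply]
  simp [rootJac, Matrix.mulVec, dotProduct, Fin.sum_univ_two]

/-- `det D(rootChart) = lev'(t)`. [folklore] -/
theorem det_rootChart' (x : Fin 2 → ℝ) : (rootChart' x).det = levD (x 0) := by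
  change LinearMap.det (Matrix.toLin' (rootJac x)) = _
  rw [LinearMap.det_toLin', Matrix.det_fin_two]
  simp [rootJac]

/-- The level chart is differentiable with derivative `rootChart'`. [folklore] -/
theorem hasFDerivAt_rootChart (x : Fin 2 → ℝ) : HasFDerivAt rootChart (rootChart' x) x := by
  have h0 : HasFDerivAt (fun y : Fin 2 → ℝ => y 0)
      (ContinuousLinearMap.proj (R := ℝ) (φ := fun _ : Fin 2 => ℝ) 0) x := hasFDerivAt_apply 0 x
  have h1 : HasFDerivAt (fun y : Fin 2 → ℝ => y 1)
      (ContinuousLinearMap.proj (R := ℝ) (φ := fun _ : Fin 2 => ℝ) 1) x := hasFDerivAt_apply 1 x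
  rw [hasFDerivAt_pi']
  refine Fin.forall_fin_two.mpr ⟨?_, ?_⟩
  · have hf : (fun y : Fin 2 → ℝ => rootChart y 0) = lev ∘ fun y => y 0 := funext fun y => rfl
    rw [hf]
    refine ((hasDerivAt_lev (x 0)).hasFDerivAt.comp x h0).congr_fderiv
      (ContinuousLinearMap.ext fun v => ?_)
    simp [mul_comm]
  · have hf : (fun y : Fin 2 → ℝ => rootChart y 1) = fun y => y 1 := funext fun y => rfl
    rw [hf]
    exact h1.congr_fderiv (ContinuousLinearMap.ext fun v => by simp)

/-- Substitution polynomials of the level chart. [folklore] -/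
def rootSubst : Fin 2 → MvPolynomial (Fin 2) ℚ := ![levPoly, X 1]

/-- Evaluating the substitution polynomials is the level chart. [folklore] -/
theorem aeval_rootSubst (x : Fin 2 → ℝ) : (fun i => aeval x (rootSubst i)) = rootChart x := by
  funext i
  fin_cases i
  · simp [rootSubst, aeval_levPoly]
  · simp [rootSubst]

/-- The level chart is a `ℚ`-semialgebraic (polynomial) map on any `ℚ`-semialgebraic set. [folklore] -/
theorem isSemialgebraicMapOn_rootChart {S : Set (Fin 2 → ℝ)} (hS : IsSemialgebraic ℚ S) :
    IsSemialgebraicMapOn ℚ S rootChart := by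
  convert isSemialgebraicMapOn_aeval hS rootSubst using 2 with z
  exact (aeval_rootSubst z).symm

/-- The level chart is injective on `Σ_neg`. [folklore] -/
theorem injOn_rootChart : InjOn rootChart negCell := by
  intro x hx y hy hxy
  have e0 : lev (x 0) = lev (y 0) := by simpa using congrFun hxy 0
  have e1 : x 1 = y 1 := by simpa using congrFun hxy 1
  have h0 : x 0 = y 0 := lev_injOn ⟨hx.1, hx.2.1⟩ ⟨hy.1, hy.2.1⟩ e0
  funext i
  fin_cases i
  · exact h0
  · exact e1

/-- The level chart maps `Σ_neg` into itself. [folklore] -/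
theorem mapsTo_rootChart : MapsTo rootChart negCell negCell := fun _ hx =>
  ⟨(lev_mem_Ioo ⟨hx.1, hx.2.1⟩).1, (lev_mem_Ioo ⟨hx.1, hx.2.1⟩).2, hx.2.2⟩

/-- The level chart maps `Σ_neg` ONTO itself. [folklore] -/
theorem image_rootChart_negCell : rootChart '' negCell = negCell := by
  refine mapsTo_rootChart.image_subset.antisymm fun y hy => ?_
  obtain ⟨t, ht, htu⟩ := exists_lev_eq hy.1 hy.2.1
  refine ⟨![t, y 1], ⟨ht.1, ht.2, hy.2.2⟩, ?_⟩
  funext i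
  fin_cases i
  · simpa using htu
  · simp

/-- **Jacobian identity of move 1**: on `Σ_neg`,
`tFun s (t,a) = negFun s (lev t, a) · |lev'(t)|`. [folklore] -/
theorem tFun_eq_negFun_rootChart {s : ℚ} {x : Fin 2 → ℝ} (hx : x ∈ negCell) :
    tFun s x = negFun s (rootChart x) * |(rootChart' x).det| := by
  rw [det_rootChart', abs_of_pos (levD_pos hx.2.1)]
  simp only [negFun, tFun, rootChart_apply_zero, rootChart_apply_one]
  have hQ : (x 1) ^ 2 * (3 - x 1) ^ 2 - 4 * lev (x 0) * x 1 = Qf (x 1) (lev (x 0)) := by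
    unfold Qf; ring
  rw [hQ]
  ring

/-- **Move 1 is ONE rule-(2) instance**: for any representations `R = [Σ_neg, tFun s]` and
`r = [Σ_neg, negFun s]` (integrands pinned on the domain only), `[R] − [r] ∈ changeOfVariablesRel`
along the level chart. [cite: KontsevichZagier2001, §1.2 rule (2)] -/
theorem rootChart_move {s : ℚ} (R r : IntegralRep 2) (hR : R.domain = negCell)
    (hRi : EqOn R.integrand (tFun s) R.domain) (hr : r.domain = negCell)
    (hri : EqOn r.integrand (negFun s) r.domain) : of R - of r ∈ changeOfVariablesRel := by
  refine ⟨2, R, r, rootChart, rootChart', ?_, fun x _ => (hasFDerivAt_rootChart x).hasFDerivWithinAt,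
    ?_, ?_, fun x hx => ?_, rfl⟩
  · rw [hR]; exact isSemialgebraicMapOn_rootChart isSemialgebraic_negCell
  · rw [hR]; exact injOn_rootChart
  · rw [hr, hR, image_rootChart_negCell]
  · have hx' : x ∈ negCell := hR ▸ hx
    rw [hRi hx, hri (by rw [hr]; exact mapsTo_rootChart hx'), tFun_eq_negFun_rootChart hx']

end Summit.KontsevichZagierPeriods.TerasomaMultiplication.NegativeBranchToMaxCell

end
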